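import Literature.Topology.FourManifolds.KhCurlStates
import Literature.Topology.FourManifolds.KhActCoeff
import Literature.Topology.FourManifolds.KhFaces
import HarnessLib

/-!
# The curl of the first Reidemeister move: the differential of the curled diagram

Sibling file of `KhComplex.lean`, continuing `KhCurlArcs`, `KhCurlStates` in the invariance
programme for `Literature.Topology.FourManifolds.GaussDiagram.nonempty_iso_khovanovHomology_of_equiv`
(Khovanov (2000), Thm. 1; first Reidemeister move: Khovanov (2000), §5.1–5.2, Bar-Natan (2002),
§4). In the basis `curlLoopES s x`, `curlThruES s` of the enhanced states of the curled diagram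
`G.curl tf ε` (`KhCurlStates`), the incidence numbers of its Khovanov complex over
`A = R[X]/(X² - hX - t)` are, for every `(R, h, t)` and *every* Gauss diagram `G`:

* `incidence_curlLoopES_curlLoopES` — between states with the curl resolved à la Seifert:
  `⟨d (s, x), (u, y)⟩ = [x = y] ⟨d s, u⟩` (**`C(D ⊔ ○) = C(D) ⊗ A` as complexes**);
* `incidence_curlThruES_curlThruES` — between states with the curl resolved the other way:
  `⟨d s, u⟩` (**the copy of `C(D)` is a copy as a complex**; old chords keep their Koszul signs);
* `incidence_curlLoopES_curlThruES` — across, for a positive curl (a merge, `KhCurlArcs`):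
  `(-1)^{|s|} · actCoeff x s u`, **multiplication of the loop label into the circle of the base
  arc** (`KhActCoeff`), with the Koszul sign of the last chord (`KhInsertChord`);
* `incidence_curlThruES_curlLoopES` — across, for a negative curl (a split):
  `(-1)^{|s|} · coactCoeff y s u`, **comultiplication of the circle of the base arc**;
* `incidence_curlThruES_curlLoopES_of_eq_one`, `incidence_curlLoopES_curlThruES_of_eq_neg_one` —
  the other cross terms vanish (the curl chord only flips `0 → 1`).

This is the matrix form of Khovanov (2000), §5.1–5.2: `C(D') ` is the cone of
`m : C(D) ⊗ A → C(D)` (positive curl), resp. of `Δ : C(D) → C(D) ⊗ A` (negative curl).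
No named fact is introduced.

## References

* M. Khovanov, *A categorification of the Jones polynomial*, Duke Math. J. 101 (2000) 359–426,
  §5.1 (left-twisted curl: `Δ`), §5.2 (right-twisted curl: `m`), §4.2. [cite: Khovanov2000, §5.1]
* D. Bar-Natan, *On Khovanov's categorification of the Jones polynomial*, Algebr. Geom. Topol. 2
  (2002) 337–370, §4. [cite: BarNatan2002, §4]
* O. Viro, *Khovanov homology, its definitions and ramifications*, Fund. Math. 184 (2004), §5.2
  (incidence numbers). [cite: Viro2004, §5.2]
-/

open Function Set

noncomputable section

namespace Literature.Topology.FourManifolds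

namespace GaussDiagram

variable {G : GaussDiagram} (tf : Bool) (ε : ℤˣ) (R : Type) [CommRing R]

/-! ## Labels of the local strands at old chords -/

/-- The incoming local strand at an old chord, read on `curlLoopES s x`. [folklore] -/
@[simp]
theorem curlLoopES_label_arcIn_castSucc (s : G.EnhancedState) (x : Bool) (q : Fin (2 * G.n)) :
    (curlLoopES tf ε s x).label ((G.curl tf ε).arcIn q.castSucc.castSucc) = s.label (G.arcIn q) := by
  rw [curlLoopES_label_of_ne tf ε s x (G.arcIn_castSucc_ne_curlLoop tf ε q), curlProj_arcIn_castSucc]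

/-- The outgoing local strand at an old chord, read on `curlLoopES s x`. [folklore] -/
@[simp]
theorem curlLoopES_label_arcOut_castSucc (s : G.EnhancedState) (x : Bool) (q : Fin (2 * G.n)) :
    (curlLoopES tf ε s x).label ((G.curl tf ε).arcOut q.castSucc.castSucc) = s.label (G.arcOut q) := by
  rw [curlLoopES_label_of_ne tf ε s x (G.arcOut_castSucc_ne_curlLoop tf ε q), curlProj_arcOut_castSucc]

/-- The incoming local strand at an old chord, read on `curlThruES s`. [folklore] -/
@[simp]
theorem curlThruES_label_arcIn_castSucc (s : G.EnhancedState) (q : Fin (2 * G.n)) :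
    (curlThruES tf ε s).label ((G.curl tf ε).arcIn q.castSucc.castSucc) = s.label (G.arcIn q) := by
  rw [curlThruES_label, curlProj_arcIn_castSucc]

/-- The outgoing local strand at an old chord, read on `curlThruES s`. [folklore] -/
@[simp]
theorem curlThruES_label_arcOut_castSucc (s : G.EnhancedState) (q : Fin (2 * G.n)) :
    (curlThruES tf ε s).label ((G.curl tf ε).arcOut q.castSucc.castSucc) = s.label (G.arcOut q) := by
  rw [curlThruES_label, curlProj_arcOut_castSucc]

/-- The loop read on `curlThruES s` carries the label of the base arc. [folklore] -/
@[simp]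
theorem curlThruES_label_curlLoop (s : G.EnhancedState) :
    (curlThruES tf ε s).label (G.curlLoop tf ε) = s.label G.baseArc := by
  rw [curlThruES_label, curlProj_curlLoop]

/-- The local strand half read on `curlThruES s` carries the label of the base arc. [folklore] -/
@[simp]
theorem curlThruES_label_curlStrand (s : G.EnhancedState) :
    (curlThruES tf ε s).label (G.curlStrand tf ε) = s.label G.baseArc := by
  rw [curlThruES_label, curlProj_curlStrand]

/-- The local strand half read on `curlLoopES s x` carries the label of the base arc. [folklore] -/
@[simp]
theorem curlLoopES_label_curlStrand (s : G.EnhancedState) (x : Bool) :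
    (curlLoopES tf ε s x).label (G.curlStrand tf ε) = s.label G.baseArc := by
  rw [curlLoopES_label_of_ne tf ε s x (G.curlStrand_ne_curlLoop tf ε), curlProj_curlStrand]

/-! ## Label conditions -/

/-- In Seifert's smoothing of the curl, an arc off the loop lies on the circle of a lifted arc iff
the projections lie on one circle. [folklore] -/
theorem circleOf_curlLift_eq_iff (τ : G.State) (c : G.Arc) {a' : (G.curl tf ε).Arc}
    (ha : a' ≠ G.curlLoop tf ε) :
    (G.curl tf ε).circleOf (G.curlState tf ε τ (curlSeifBit ε)) (G.curlLift tf ε c) =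
        (G.curl tf ε).circleOf (G.curlState tf ε τ (curlSeifBit ε)) a' ↔
      G.circleOf τ c = G.circleOf τ (G.curlProj tf ε a') := by
  rw [G.circleOf_curl_eq_iff_of_seif tf ε τ _ (curlSeif_curlSeifBit ε)]
  have h1 := G.curlLift_ne_curlLoop tf ε c
  simp [h1, ha]

/-- **The label condition between two `curlLoopES`** (in a state with the curl resolved à la
Seifert, at a local strand `a'` off the loop): labels agree off the circle of `a'` iff the loop
labels agree and the old labels agree off the circle of the projection of `a'`. [folklore] -/
theorem labelCond_curlLoopES_iff (τ : G.State) (s u : G.EnhancedState) (x y : Bool)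
    {a' : (G.curl tf ε).Arc} (ha : a' ≠ G.curlLoop tf ε) :
    (∀ c', (G.curl tf ε).circleOf (G.curlState tf ε τ (curlSeifBit ε)) c' ≠
        (G.curl tf ε).circleOf (G.curlState tf ε τ (curlSeifBit ε)) a' →
          (curlLoopES tf ε u y).label c' = (curlLoopES tf ε s x).label c') ↔
      (x = y ∧ ∀ c, G.circleOf τ c ≠ G.circleOf τ (G.curlProj tf ε a') → u.label c = s.label c) := by
  constructor
  · intro H
    refine ⟨?_, fun c hc ↦ ?_⟩
    · have := H (G.curlLoop tf ε) (by
        rw [Ne, G.circleOf_curl_eq_iff_of_seif tf ε τ _ (curlSeif_curlSeifBit ε)]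
        simp [ha])
      simpa using this.symm
    · have := H (G.curlLift tf ε c) (by rwa [Ne, G.circleOf_curlLift_eq_iff tf ε τ c ha])
      simpa using this
  · rintro ⟨rfl, H⟩ c' hc'
    by_cases hcL : c' = G.curlLoop tf ε
    · subst hcL; simp
    · rw [curlLoopES_label_of_ne tf ε u x hcL, curlLoopES_label_of_ne tf ε s x hcL]
      refine H _ fun hc ↦ hc' ?_
      rw [G.circleOf_curl_eq_iff_of_seif tf ε τ _ (curlSeif_curlSeifBit ε)]
      exact ⟨⟨fun h ↦ (hcL h).elim, fun h ↦ (ha h).elim⟩, fun _ ↦ hc⟩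

/-- **The label condition between two `curlThruES`** (in a state with the curl resolved against
Seifert): labels agree off the circle of `a'` iff the old labels agree off the circle of its
projection. [folklore] -/
theorem labelCond_curlThruES_iff (τ : G.State) (s u : G.EnhancedState) (a' : (G.curl tf ε).Arc) :
    (∀ c', (G.curl tf ε).circleOf (G.curlState tf ε τ (!curlSeifBit ε)) c' ≠
        (G.curl tf ε).circleOf (G.curlState tf ε τ (!curlSeifBit ε)) a' →
          (curlThruES tf ε u).label c' = (curlThruES tf ε s).label c') ↔
      ∀ c, G.circleOf τ c ≠ G.circleOf τ (G.curlProj tf ε a') → u.label c = s.label c := by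
  simp only [Ne, G.circleOf_curl_eq_iff_of_not_seif tf ε τ _ (curlSeif_not_curlSeifBit ε),
    curlThruES_label]
  constructor
  · intro H c hc
    simpa using H (G.curlLift tf ε c) (by simpa using hc)
  · intro H c' hc'
    exact H _ hc'

/-- **The label condition across the curl**, between `curlThruES u` and `curlLoopES s x` in a
state with the curl resolved against Seifert, at a local strand projecting to the base arc: the
loop imposes nothing (it lies on the circle of the base arc), and the old labels must agree off
the circle of the base arc. [folklore] -/
theorem labelCond_curlThruES_curlLoopES_iff (τ : G.State) (s u : G.EnhancedState) (x : Bool)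
    {a' : (G.curl tf ε).Arc} (ha : G.curlProj tf ε a' = G.baseArc) :
    (∀ c', (G.curl tf ε).circleOf (G.curlState tf ε τ (!curlSeifBit ε)) c' ≠
        (G.curl tf ε).circleOf (G.curlState tf ε τ (!curlSeifBit ε)) a' →
          (curlThruES tf ε u).label c' = (curlLoopES tf ε s x).label c') ↔
      ∀ c, G.circleOf τ c ≠ G.circleOf τ G.baseArc → u.label c = s.label c := by
  simp only [Ne, G.circleOf_curl_eq_iff_of_not_seif tf ε τ _ (curlSeif_not_curlSeifBit ε),
    curlThruES_label, ha]
  constructor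
  · intro H c hc
    simpa using H (G.curlLift tf ε c) (by simpa using hc)
  · intro H c' hc'
    have hcL : c' ≠ G.curlLoop tf ε := by rintro rfl; simp at hc'
    rw [curlLoopES_label_of_ne tf ε s x hcL]
    exact H _ hc'

/-- The same label condition with the roles of the two enhanced states exchanged (used for the
split, whose condition is read in the source state). [folklore] -/
theorem labelCond_curlLoopES_curlThruES_iff (τ : G.State) (s u : G.EnhancedState) (y : Bool)
    {a' : (G.curl tf ε).Arc} (ha : G.curlProj tf ε a' = G.baseArc) :
    (∀ c', (G.curl tf ε).circleOf (G.curlState tf ε τ (!curlSeifBit ε)) c' ≠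
        (G.curl tf ε).circleOf (G.curlState tf ε τ (!curlSeifBit ε)) a' →
          (curlLoopES tf ε u y).label c' = (curlThruES tf ε s).label c') ↔
      ∀ c, G.circleOf τ c ≠ G.circleOf τ G.baseArc → u.label c = s.label c := by
  simp only [Ne, G.circleOf_curl_eq_iff_of_not_seif tf ε τ _ (curlSeif_not_curlSeifBit ε),
    curlThruES_label, ha]
  constructor
  · intro H c hc
    simpa using H (G.curlLift tf ε c) (by simpa using hc)
  · intro H c' hc'
    have hcL : c' ≠ G.curlLoop tf ε := by rintro rfl; simp at hc'
    rw [curlLoopES_label_of_ne tf ε u y hcL]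
    exact H _ hc'

/-! ## Which pairs of states of the curled diagram differ by a single flip -/

/-- A flip between two `curlLoopES` states is the flip of an old chord. [folklore] -/
theorem exists_flip_of_curlLoopES_flip {s u : G.EnhancedState} {x y : Bool} {j : Fin (G.n + 1)}
    (hj : (curlLoopES tf ε s x).state j = false)
    (hu : (curlLoopES tf ε u y).state = Function.update (curlLoopES tf ε s x).state j true) :
    ∃ i : Fin G.n, j = i.castSucc ∧ s.state i = false ∧ u.state = Function.update s.state i true := by
  induction j using Fin.lastCases with
  | last =>
    have h1 := congrFun hu (Fin.last G.n)
    rw [Function.update_self] at h1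
    rw [curlLoopES_state, curlState_last] at hj
    rw [curlLoopES_state, curlState_last, hj] at h1
    exact (Bool.false_ne_true h1).elim
  | cast i =>
    refine ⟨i, rfl, by simpa using hj, ?_⟩
    rw [curlLoopES_state, curlLoopES_state, update_curlState_castSucc] at hu
    exact (G.curlState_inj tf ε hu).1

/-- A flip between two `curlThruES` states is the flip of an old chord. [folklore] -/
theorem exists_flip_of_curlThruES_flip {s u : G.EnhancedState} {j : Fin (G.n + 1)}
    (hj : (curlThruES tf ε s).state j = false)
    (hu : (curlThruES tf ε u).state = Function.update (curlThruES tf ε s).state j true) :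
    ∃ i : Fin G.n, j = i.castSucc ∧ s.state i = false ∧ u.state = Function.update s.state i true := by
  induction j using Fin.lastCases with
  | last =>
    have h1 := congrFun hu (Fin.last G.n)
    rw [Function.update_self] at h1
    rw [curlThruES_state, curlState_last] at hj
    rw [curlThruES_state, curlState_last, hj] at h1
    exact (Bool.false_ne_true h1).elim
  | cast i =>
    refine ⟨i, rfl, by simpa using hj, ?_⟩
    rw [curlThruES_state, curlThruES_state, update_curlState_castSucc] at hu
    exact (G.curlState_inj tf ε hu).1

/-- A flip from a `curlLoopES` to a `curlThruES` state is the flip of the curl chord of a positive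
curl, between equal old states. [folklore] -/
theorem eq_of_curlLoopES_curlThruES_flip {s u : G.EnhancedState} {x : Bool} {j : Fin (G.n + 1)}
    (hj : (curlLoopES tf ε s x).state j = false)
    (hu : (curlThruES tf ε u).state = Function.update (curlLoopES tf ε s x).state j true) :
    j = Fin.last G.n ∧ ε = 1 ∧ u.state = s.state := by
  induction j using Fin.lastCases with
  | last =>
    rw [curlLoopES_state, curlState_last] at hj
    have hε : ε = 1 := by
      have h3 := curlSeif_curlSeifBit ε
      rw [hj] at h3
      exact (curlSeif_false_iff ε).1 h3
    refine ⟨rfl, hε, ?_⟩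
    rw [curlThruES_state, curlLoopES_state, update_curlState_last] at hu
    exact (G.curlState_inj tf ε hu).1
  | cast i =>
    rw [curlThruES_state, curlLoopES_state, update_curlState_castSucc] at hu
    have h1 := (G.curlState_inj tf ε hu).2
    cases hb : curlSeifBit ε <;> simp [hb] at h1

/-- A flip from a `curlThruES` to a `curlLoopES` state is the flip of the curl chord of a negative
curl, between equal old states. [folklore] -/
theorem eq_of_curlThruES_curlLoopES_flip {s u : G.EnhancedState} {y : Bool} {j : Fin (G.n + 1)}
    (hj : (curlThruES tf ε s).state j = false)
    (hu : (curlLoopES tf ε u y).state = Function.update (curlThruES tf ε s).state j true) :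
    j = Fin.last G.n ∧ ε = -1 ∧ u.state = s.state := by
  induction j using Fin.lastCases with
  | last =>
    rw [curlThruES_state, curlState_last] at hj
    have hε : ε = -1 := by
      have h2 : curlSeifBit ε = true := by simpa using hj
      have h3 := curlSeif_curlSeifBit ε
      rw [h2] at h3
      exact (curlSeif_true_iff ε).1 h3
    refine ⟨rfl, hε, ?_⟩
    rw [curlThruES_state, curlLoopES_state, update_curlState_last] at hu
    exact (G.curlState_inj tf ε hu).1
  | cast i =>
    rw [curlLoopES_state, curlThruES_state, update_curlState_castSucc] at hu
    have h1 := (G.curlState_inj tf ε hu).2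
    cases hb : curlSeifBit ε <;> simp [hb] at h1

/-! ## The incidence numbers of the curled diagram -/

/-- **`C(D ⊔ ○) = C(D) ⊗ A` as complexes**: between enhanced states with the curl resolved à la
Seifert the incidence number is the old one when the loop labels agree, and `0` otherwise (old
chords merge/split as before with the same Koszul signs; the isolated loop must keep its label).
Khovanov (2000), §5.1–5.2; Bar-Natan (2002), §4. [cite: Khovanov2000, §5.1] -/
theorem incidence_curlLoopES_curlLoopES (h t : R) (s u : G.EnhancedState) (x y : Bool) :
    (G.curl tf ε).incidence R h t (curlLoopES tf ε s x) (curlLoopES tf ε u y) =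
      if x = y then G.incidence R h t s u else 0 := by
  by_cases hfl : ∃ i, s.state i = false ∧ u.state = Function.update s.state i true
  · obtain ⟨i, hi, hu⟩ := hfl
    have hi' : (curlLoopES tf ε s x).state i.castSucc = false := by
      rw [curlLoopES_state, curlState_castSucc]; exact hi
    have hu' : (curlLoopES tf ε u y).state =
        Function.update (curlLoopES tf ε s x).state i.castSucc true := by
      rw [curlLoopES_state, curlLoopES_state, update_curlState_castSucc, hu]
    rw [incidence_of_flip R h t hi' hu', incidence_of_flip R h t hi hu, curlLoopES_state tf ε s x,
      curlLoopES_state tf ε u y, edgeSign_curlState_castSucc, overPos_curl_castSucc,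
      curlLoopES_label_arcIn_castSucc tf ε s x, curlLoopES_label_arcOut_castSucc tf ε s x,
      curlLoopES_label_arcIn_castSucc tf ε u y, curlLoopES_label_arcOut_castSucc tf ε u y]
    have hM := G.isMergeAt_curl_castSucc_iff tf ε s.state (curlSeifBit ε) i
    have hS := G.isSplitAt_curl_castSucc_iff tf ε s.state (curlSeifBit ε) i
    have hne := G.arcIn_castSucc_ne_curlLoop tf ε (G.overPos i)
    have hcondM := G.labelCond_curlLoopES_iff tf ε u.state s u x y hne
    have hcondS := G.labelCond_curlLoopES_iff tf ε s.state s u x y hne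
    rw [curlProj_arcIn_castSucc] at hcondM hcondS
    by_cases h1 : G.IsMergeAt s.state i
    · rw [if_pos h1, if_pos (hM.2 h1)]
      by_cases h2 : ∀ c, G.circleOf u.state c ≠ G.circleOf u.state (G.arcIn (G.overPos i)) →
          u.label c = s.label c
      · by_cases hxy : x = y
        · rw [if_pos (hcondM.2 ⟨hxy, h2⟩), if_pos h2, if_pos hxy]
        · rw [if_neg (fun H ↦ hxy (hcondM.1 H).1), if_neg hxy]
      · rw [if_neg (fun H ↦ h2 (hcondM.1 H).2), if_neg h2, ite_self]
    · rw [if_neg h1, if_neg (mt hM.1 h1)]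
      by_cases h3 : G.IsSplitAt s.state i
      · rw [if_pos h3, if_pos (hS.2 h3)]
        by_cases h4 : ∀ c, G.circleOf s.state c ≠ G.circleOf s.state (G.arcIn (G.overPos i)) →
            u.label c = s.label c
        · by_cases hxy : x = y
          · rw [if_pos (hcondS.2 ⟨hxy, h4⟩), if_pos h4, if_pos hxy]
          · rw [if_neg (fun H ↦ hxy (hcondS.1 H).1), if_neg hxy]
        · rw [if_neg (fun H ↦ h4 (hcondS.1 H).2), if_neg h4, ite_self]
      · rw [if_neg h3, if_neg (mt hS.1 h3), ite_self]
  · rw [incidence_of_not_flip R h t hfl, incidence_of_not_flip R h t, ite_self]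
    rintro ⟨j, hj, hj'⟩
    obtain ⟨i, -, hi, hu⟩ := G.exists_flip_of_curlLoopES_flip tf ε hj hj'
    exact hfl ⟨i, hi, hu⟩

/-- **The copy of `C(D)` inside `C(D')` is a copy as a complex**: between enhanced states with the
curl resolved against Seifert the incidence number is the old one (old chords merge/split as
before, with the same Koszul signs since the curl chord is the last one). Khovanov (2000),
§5.1–5.2; Bar-Natan (2002), §4. [cite: Khovanov2000, §5.1] -/
theorem incidence_curlThruES_curlThruES (h t : R) (s u : G.EnhancedState) :
    (G.curl tf ε).incidence R h t (curlThruES tf ε s) (curlThruES tf ε u) = G.incidence R h t s u := by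
  by_cases hfl : ∃ i, s.state i = false ∧ u.state = Function.update s.state i true
  · obtain ⟨i, hi, hu⟩ := hfl
    have hi' : (curlThruES tf ε s).state i.castSucc = false := by
      rw [curlThruES_state, curlState_castSucc]; exact hi
    have hu' : (curlThruES tf ε u).state =
        Function.update (curlThruES tf ε s).state i.castSucc true := by
      rw [curlThruES_state, curlThruES_state, update_curlState_castSucc, hu]
    rw [incidence_of_flip R h t hi' hu', incidence_of_flip R h t hi hu, curlThruES_state tf ε s,
      curlThruES_state tf ε u, edgeSign_curlState_castSucc, overPos_curl_castSucc,
      curlThruES_label_arcIn_castSucc tf ε s, curlThruES_label_arcOut_castSucc tf ε s,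
      curlThruES_label_arcIn_castSucc tf ε u, curlThruES_label_arcOut_castSucc tf ε u]
    have hM := G.isMergeAt_curl_castSucc_iff tf ε s.state (!curlSeifBit ε) i
    have hS := G.isSplitAt_curl_castSucc_iff tf ε s.state (!curlSeifBit ε) i
    have hcondM := G.labelCond_curlThruES_iff tf ε u.state s u
      ((G.curl tf ε).arcIn (G.overPos i).castSucc.castSucc)
    have hcondS := G.labelCond_curlThruES_iff tf ε s.state s u
      ((G.curl tf ε).arcIn (G.overPos i).castSucc.castSucc)
    rw [curlProj_arcIn_castSucc] at hcondM hcondS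
    by_cases h1 : G.IsMergeAt s.state i
    · rw [if_pos h1, if_pos (hM.2 h1)]
      by_cases h2 : ∀ c, G.circleOf u.state c ≠ G.circleOf u.state (G.arcIn (G.overPos i)) →
          u.label c = s.label c
      · rw [if_pos (hcondM.2 h2), if_pos h2]
      · rw [if_neg (mt hcondM.1 h2), if_neg h2]
    · rw [if_neg h1, if_neg (mt hM.1 h1)]
      by_cases h3 : G.IsSplitAt s.state i
      · rw [if_pos h3, if_pos (hS.2 h3)]
        by_cases h4 : ∀ c, G.circleOf s.state c ≠ G.circleOf s.state (G.arcIn (G.overPos i)) →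
            u.label c = s.label c
        · rw [if_pos (hcondS.2 h4), if_pos h4]
        · rw [if_neg (mt hcondS.1 h4), if_neg h4]
      · rw [if_neg h3, if_neg (mt hS.1 h3)]
  · rw [incidence_of_not_flip R h t hfl, incidence_of_not_flip R h t]
    rintro ⟨j, hj, hj'⟩
    obtain ⟨i, -, hi, hu⟩ := G.exists_flip_of_curlThruES_flip tf ε hj hj'
    exact hfl ⟨i, hi, hu⟩

/-- The two local strands at the curl chord and their labels on `curlLoopES s x`: the
multiplication table is read with the base-arc label and the loop label in some order, which does
not matter by commutativity. [folklore] -/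
theorem mergeCoeff_strands_curl_last (h t : R) (s u : G.EnhancedState) (x : Bool) :
    mergeCoeff R h t ((curlLoopES tf ε s x).label ((G.curl tf ε).arcIn ((G.curl tf ε).overPos (Fin.last G.n))))
        ((curlLoopES tf ε s x).label ((G.curl tf ε).arcOut ((G.curl tf ε).overPos (Fin.last G.n))))
        ((curlThruES tf ε u).label ((G.curl tf ε).arcIn ((G.curl tf ε).overPos (Fin.last G.n)))) =
      mergeCoeff R h t (s.label G.baseArc) x (u.label G.baseArc) := by
  rw [arcIn_overPos_curl_last, arcOut_overPos_curl_last]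
  cases tf
  · simp only [Bool.false_eq_true, ↓reduceIte, curlLoopES_label_curlLoop, curlLoopES_label_curlStrand,
      curlThruES_label_curlLoop]
    exact KhFace.mergeCoeff_comm (R := R) (h := h) (t := t) _ _ _
  · simp

/-- The two local strands at the curl chord and their labels for the split: the comultiplication
table is read with the loop as one of the two outputs, in some order which does not matter by
cocommutativity. [folklore] -/
theorem splitCoeff_strands_curl_last (h t : R) (s u : G.EnhancedState) (y : Bool) :
    splitCoeff R h t ((curlThruES tf ε s).label ((G.curl tf ε).arcIn ((G.curl tf ε).overPos (Fin.last G.n))))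
        ((curlLoopES tf ε u y).label ((G.curl tf ε).arcIn ((G.curl tf ε).overPos (Fin.last G.n))))
        ((curlLoopES tf ε u y).label ((G.curl tf ε).arcOut ((G.curl tf ε).overPos (Fin.last G.n)))) =
      splitCoeff R h t (s.label G.baseArc) (u.label G.baseArc) y := by
  rw [arcIn_overPos_curl_last, arcOut_overPos_curl_last]
  cases tf
  · simp only [Bool.false_eq_true, ↓reduceIte, curlThruES_label_curlLoop, curlLoopES_label_curlLoop,
      curlLoopES_label_curlStrand]
    exact KhFace.splitCoeff_comm (R := R) (h := h) (t := t) _ _ _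
  · simp

/-- **The curl edge of a positive curl is multiplication**: from `curlLoopES s x` (curl
`0`-smoothed, à la Seifert) to `curlThruES u` (curl `1`-smoothed) the incidence number is
`(-1)^{|s|} · actCoeff x s u` — the loop label `x` is multiplied into the circle of the base arc,
with the Koszul sign of the last chord. Khovanov (2000), §5.2 (the map `m` of the right-twisted
curl); Bar-Natan (2002), §4. [cite: Khovanov2000, §5.2] -/
theorem incidence_curlLoopES_curlThruES (hε : ε = 1) (h t : R) (s u : G.EnhancedState) (x : Bool) :
    (G.curl tf ε).incidence R h t (curlLoopES tf ε s x) (curlThruES tf ε u) =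
      (-1) ^ s.state.weight * actCoeff R h t G.baseArc x s u := by
  subst hε
  by_cases hsu : u.state = s.state
  · have hi' : (curlLoopES tf 1 s x).state (Fin.last G.n) = false := by
      rw [curlLoopES_state, curlState_last, curlSeifBit_one]
    have hu' : (curlThruES tf 1 u).state =
        Function.update (curlLoopES tf 1 s x).state (Fin.last G.n) true := by
      rw [curlThruES_state, curlLoopES_state, update_curlState_last, hsu, curlSeifBit_one]
      rfl
    have hMg : (G.curl tf 1).IsMergeAt (G.curlState tf 1 s.state (curlSeifBit 1)) (Fin.last G.n) :=
      (G.isMergeAt_curl_last_iff tf 1 s.state _).2 ⟨curlSeifBit_one, rfl⟩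
    have ha : G.curlProj tf 1 ((G.curl tf 1).arcIn ((G.curl tf 1).overPos (Fin.last G.n))) =
        G.baseArc := by
      rw [arcIn_overPos_curl_last]; cases tf <;> simp
    have hcond := G.labelCond_curlThruES_curlLoopES_iff tf 1 s.state s u x ha
    rw [incidence_of_flip R h t hi' hu', mergeCoeff_strands_curl_last, curlLoopES_state tf 1 s x,
      curlThruES_state tf 1 u, hsu, edgeSign_curlState_last, if_pos hMg]
    unfold actCoeff
    by_cases h2 : ∀ c, G.circleOf s.state c ≠ G.circleOf s.state G.baseArc → u.label c = s.label c
    · rw [if_pos (hcond.2 h2), if_pos ⟨hsu, h2⟩]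
      push_cast
      ring
    · rw [if_neg (mt hcond.1 h2), if_neg (fun H ↦ h2 H.2), mul_zero]
  · rw [incidence_of_not_flip R h t, actCoeff, if_neg (fun H ↦ hsu H.1), mul_zero]
    rintro ⟨j, hj, hj'⟩
    exact hsu (G.eq_of_curlLoopES_curlThruES_flip tf 1 hj hj').2.2

/-- **The curl edge of a negative curl is comultiplication**: from `curlThruES s` (curl
`0`-smoothed) to `curlLoopES u y` (curl `1`-smoothed, à la Seifert) the incidence number is
`(-1)^{|s|} · coactCoeff y s u` — the circle of the base arc is split, the loop receiving the
label `y`, with the Koszul sign of the last chord. Khovanov (2000), §5.1 (the map `Δ` of the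
left-twisted curl); Bar-Natan (2002), §4. [cite: Khovanov2000, §5.1] -/
theorem incidence_curlThruES_curlLoopES (hε : ε = -1) (h t : R) (s u : G.EnhancedState) (y : Bool) :
    (G.curl tf ε).incidence R h t (curlThruES tf ε s) (curlLoopES tf ε u y) =
      (-1) ^ s.state.weight * coactCoeff R h t G.baseArc y s u := by
  subst hε
  by_cases hsu : u.state = s.state
  · have hi' : (curlThruES tf (-1) s).state (Fin.last G.n) = false := by
      rw [curlThruES_state, curlState_last, curlSeifBit_neg_one]; rfl
    have hu' : (curlLoopES tf (-1) u y).state =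
        Function.update (curlThruES tf (-1) s).state (Fin.last G.n) true := by
      rw [curlThruES_state, curlLoopES_state, update_curlState_last, hsu, curlSeifBit_neg_one]
    have hMg : ¬ (G.curl tf (-1)).IsMergeAt (G.curlState tf (-1) s.state (!curlSeifBit (-1)))
        (Fin.last G.n) := fun H ↦
      absurd ((G.isMergeAt_curl_last_iff tf (-1) s.state _).1 H).2 (by decide)
    have hSp : (G.curl tf (-1)).IsSplitAt (G.curlState tf (-1) s.state (!curlSeifBit (-1)))
        (Fin.last G.n) :=
      (G.isSplitAt_curl_last_iff tf (-1) s.state _).2 ⟨by decide, rfl⟩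
    have ha : G.curlProj tf (-1) ((G.curl tf (-1)).arcIn ((G.curl tf (-1)).overPos (Fin.last G.n))) =
        G.baseArc := by
      rw [arcIn_overPos_curl_last]; cases tf <;> simp
    have hcond := G.labelCond_curlLoopES_curlThruES_iff tf (-1) s.state s u y ha
    rw [incidence_of_flip R h t hi' hu', splitCoeff_strands_curl_last, curlLoopES_state tf (-1) u y,
      curlThruES_state tf (-1) s, edgeSign_curlState_last, if_neg hMg, if_pos hSp]
    unfold coactCoeff
    by_cases h2 : ∀ c, G.circleOf s.state c ≠ G.circleOf s.state G.baseArc → u.label c = s.label c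
    · rw [if_pos (hcond.2 h2), if_pos ⟨hsu, h2⟩]
      push_cast
      ring
    · rw [if_neg (mt hcond.1 h2), if_neg (fun H ↦ h2 H.2), mul_zero]
  · rw [incidence_of_not_flip R h t, coactCoeff, if_neg (fun H ↦ hsu H.1), mul_zero]
    rintro ⟨j, hj, hj'⟩
    exact hsu (G.eq_of_curlThruES_curlLoopES_flip tf (-1) hj hj').2.2

/-- For a positive curl there is no edge from the `1`-smoothed to the `0`-smoothed curl: the
incidence number from `curlThruES s` to `curlLoopES u y` vanishes. [folklore] -/
theorem incidence_curlThruES_curlLoopES_of_eq_one (hε : ε = 1) (h t : R) (s u : G.EnhancedState)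
    (y : Bool) : (G.curl tf ε).incidence R h t (curlThruES tf ε s) (curlLoopES tf ε u y) = 0 := by
  refine incidence_of_not_flip R h t ?_
  rintro ⟨j, hj, hj'⟩
  have := (G.eq_of_curlThruES_curlLoopES_flip tf ε hj hj').2.1
  rw [hε] at this
  exact absurd this (by decide)

/-- For a negative curl there is no edge from the `1`-smoothed to the `0`-smoothed curl: the
incidence number from `curlLoopES s x` to `curlThruES u` vanishes. [folklore] -/
theorem incidence_curlLoopES_curlThruES_of_eq_neg_one (hε : ε = -1) (h t : R)
    (s u : G.EnhancedState) (x : Bool) :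
    (G.curl tf ε).incidence R h t (curlLoopES tf ε s x) (curlThruES tf ε u) = 0 := by
  refine incidence_of_not_flip R h t ?_
  rintro ⟨j, hj, hj'⟩
  have := (G.eq_of_curlLoopES_curlThruES_flip tf ε hj hj').2.1
  rw [hε] at this
  exact absurd this (by decide)

end GaussDiagram

end Literature.Topology.FourManifolds
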